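import Summits.Ventures.GridStability.Lyapunov.WSCC9LosslessPolytopeRate
import HarnessLib

/-!
# GridStability/Lyapunov/WSCC9LosslessPolytopeRateWindow — «SP-RATE-POLYTOPE», reading for the referees:
# ★ #110's sentence for «WSCC9-postB-L-SPdamp» VERBATIM with the level `3/50` replaced by `27/100`

Cell `gridfusion` (LADDER-GRIDFUSION), seat gridfusion-lyap-1 (g8). ★ #110 (`WSCC9LosslessRate.energy_le_mul_exp_neg`,
p550019) reads: every solution of `WSCC9LffNU.data.toModel` from the WINDOW `|δ_i(0) − δ_j(0)| < π/2` on the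
momentum leaf with `V(θ*; γ 0) ≤ 3/50` satisfies `V(θ*; γ t) ≤ (42/5)·V(θ*; γ 0)·e^{−t/28}`. The polytope-rate
instance (`WSCC9LosslessPolytopeRate.energy_le_mul_exp_neg_polytope`, p562524) proves the same inequality from
the POLYTOPE `|(δ_i − δ_j) + (θ*_i − θ*_j)| < π` with `V ≤ 27/100`. Since the window lies inside the polytope
(`|θ*_ij| < π/2`, lyap-1 g6's `window_subset_vtPolytope`), ★ #110's hypotheses with `3/50 ↦ 27/100` imply the
same conclusion: `energy_le_mul_exp_neg_of_window` below — the level of ★ #110 is multiplied by `4.5` with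
rate and gain unchanged. LABEL OF EVERY MENTION: «synthetic lossless VARIANT of the printed 9-bus with the
printed NON-UNIFORM damping — a PIPELINE sentence, not a 9-bus sentence». THREE COLUMNS as in p562524; no
sentence of this file says that the WSCC system or any grid is stable or well damped. No definition, no named
fact; standard axioms. [cite: Khalil2002, Theorem 4.10]; [cite: VuTuritsyn2016, §IV]
-/

noncomputable section

open Set Real Finset
open Summit.Ventures.GridStability.Models
open Summit.Ventures.GridStability.Lyapunov.WSCC9LffNU (data)
open Summit.Ventures.GridStability.Lyapunov.WSCC9LosslessPolytope (abs_angle_lt)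

namespace Summit.Ventures.GridStability.Lyapunov.WSCC9LosslessPolytopeRate

/-- **★ #110's sentence at the level `27/100`.** For model-1's real model `data.toModel` («WSCC9-postB-L-SPdamp»,
printed `D_i/M_i = 1/10, 1/5, 3/10`): every solution `γ = (δ, ω)` on `univ` whose initial state has every
machine pair inside the WINDOW `|δ_i(0) − δ_j(0)| < π/2`, lies on the momentum leaf
`Σ M_iω_i(0) + Σ D_iδ_i(0) = Σ D_iθ*_i` and has classical energy `V(θ*; γ 0) ≤ 27/100` satisfies, for all
`t ≥ 0`, `V(θ*; γ t) ≤ (42/5)·V(θ*; γ 0)·exp(−t/28)` (window ⊆ polytope, then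
`energy_le_mul_exp_neg_polytope`). `1/28 s⁻¹` is a LOWER bound on the model's rate in that region, not a
damping figure of any grid; no sentence here says a grid is stable or well damped.
[cite: Khalil2002, Theorem 4.10]; [cite: VuTuritsyn2016, §IV]; [cite: SauerPai1998, §7.9.3, §9] -/
theorem energy_le_mul_exp_neg_of_window {γ : ℝ → ClassicalSwing.State 3}
    (hγ : data.toModel.IsSolutionOn γ univ)
    (hwin : ∀ i j, data.toModel.Ccoef i j ≠ 0 → |(γ 0).1 i - (γ 0).1 j| < π / 2)
    (hL : ∑ i, data.toModel.M i * (γ 0).2 i + ∑ i, data.toModel.D i * (γ 0).1 i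
      = ∑ i, data.toModel.D i * data.angleOf i)
    (hV : data.toModel.energy data.angleOf (γ 0) ≤ 27 / 100) {t : ℝ} (ht : 0 ≤ t) :
    data.toModel.energy data.angleOf (γ t)
      ≤ 42 / 5 * data.toModel.energy data.angleOf (γ 0) * Real.exp (-(1 / 28) * t) := by
  refine energy_le_mul_exp_neg_polytope hγ (fun i j hij => ?_) hL hV ht
  have h1 := abs_lt.1 (hwin i j hij)
  have h2 := abs_lt.1 (abs_angle_lt (ne_of_Ccoef_ne_zero hij))
  exact abs_lt.2 ⟨by linarith [h1.1, h2.1], by linarith [h1.2, h2.2]⟩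

end Summit.Ventures.GridStability.Lyapunov.WSCC9LosslessPolytopeRate

end
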